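import HarnessLib
import Summits.RiemannHypothesis.RiemannHypothesis.Theorems.SignConePointwiseCertThreeHalvesData

/-!
# Route SignCone: pointwise certificate `pwCert32` — anchored grid groups, file 23 (first half)

Support for the unconditional rungs of `SignConeOscillatory` / `SignConeInequality`
(items stmt-RiemannHypothesis-16302 / 16301). Anchored grid groups `(w, [u₀ < u₁ < …])` of the
certificate `pwCert32` (`4` groups, `287` two-point cells on `[299.9465, 324.1145]`, in
`4` slices) and their kernel checks with the corrected fast checker (`PWData.checkAGrid₂Z`:
`w ≤ wLoQ(u₀)` at the anchor, tables `pwCert32cs/pwCert32logs`, correction `pwCert32hl`, two-point cells), combined in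
`pwCert32_groups23`. Assembled in `SignConePointwiseCertThreeHalves.lean`.
-/

-- `Summit.RiemannHypothesis.RiemannHypothesis.…` repeats a namespace component by design (D-0017 layout).
set_option linter.dupNamespace false

noncomputable section

namespace Summit.RiemannHypothesis.RiemannHypothesis.Theorems.SignCone

open Literature.Analysis.ValidatedNumerics.Numerics Literature.NumberTheory.LFunctions

/-- Anchored grid groups, file 23 slice 0 (`1` groups, `77` cells on `[299.9465, 305.8320]`). [folklore] -/
def pwCert32G23s0 : List (ℚ × List ℚ) := [
  pwCert32Grp (36098442976589665933643781/7205759403792793600000000) [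
    1228581, 1228972, 1229386, 1229829, 1230304, 1230810, 1231342, 1231888, 1232271, 1232650, 1233021, 1233383, 1233735, 1234078, 1234413, 1234743,
    1235212, 1235684, 1236170, 1236679, 1237221, 1237801, 1238420, 1239067, 1239524, 1239971, 1240397, 1240795, 1241158, 1241486, 1241779, 1242039,
    1242270, 1242476, 1242660, 1242825, 1242974, 1243109, 1243233, 1243347, 1243452, 1243550, 1243642, 1243729, 1243812, 1243892, 1243968, 1244042,
    1244114, 1244185, 1244284, 1244382, 1244480, 1244579, 1244680, 1244784, 1244893, 1245008, 1245134, 1245271, 1245423, 1245594, 1245789, 1246016,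
    1246284, 1246607, 1247001, 1247484, 1248072, 1248765, 1249524, 1250078, 1250618, 1251124, 1251584, 1251995, 1252361, 1252688]]

/-- Anchored grid groups, file 23 slice 1 (`1` groups, `74` cells on `[305.8320, 311.7944]`). [folklore] -/
def pwCert32G23s1 : List (ℚ × List ℚ) := [
  pwCert32Grp (18119229032953094025610953/3602879701896396800000000) [
    1252688, 1252985, 1253257, 1253511, 1253752, 1254086, 1254417, 1254756, 1255127, 1255539, 1256010, 1256555, 1257181, 1257864, 1258371, 1258877,
    1259364, 1259819, 1260234, 1260609, 1260946, 1261249, 1261523, 1261772, 1262000, 1262210, 1262404, 1262586, 1262756, 1262917, 1263070, 1263216,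
    1263356, 1263491, 1263622, 1263750, 1263875, 1263997, 1264169, 1264339, 1264508, 1264677, 1264848, 1265023, 1265203, 1265390, 1265586, 1265794,
    1266022, 1266271, 1266547, 1266858, 1267213, 1267625, 1268108, 1268675, 1269330, 1270045, 1270578, 1271112, 1271630, 1272118, 1272570, 1272985,
    1273367, 1273720, 1274051, 1274364, 1274665, 1274958, 1275371, 1275785, 1276208, 1276648, 1277110]]

set_option maxHeartbeats 0 in
/-- **Kernel check of slice 0 of file 23.** [folklore] -/
theorem pwCert32G23s0_ok : (pwCert32G23s0.all (pwCert32.checkAGrid₂Z pwCert32cs pwCert32logs pwCert32fac pwCert32hl)) = true := by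
  decide +kernel

set_option maxHeartbeats 0 in
/-- **Kernel check of slice 1 of file 23.** [folklore] -/
theorem pwCert32G23s1_ok : (pwCert32G23s1.all (pwCert32.checkAGrid₂Z pwCert32cs pwCert32logs pwCert32fac pwCert32hl)) = true := by
  decide +kernel

end Summit.RiemannHypothesis.RiemannHypothesis.Theorems.SignCone

end
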